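import Summits.BirchSwinnertonDyer.Rank1Residual.Additive.ChiBranchConstantTerm
import Summits.BirchSwinnertonDyer.Rank1Residual.Additive.SemistableTwistAnalytic
import Summits.BirchSwinnertonDyer.Rank1Residual.Additive.QuadraticTwistTypeGOrd
import Summits.BirchSwinnertonDyer.Rank1Residual.EisensteinPrimes
import Literature.NumberTheory.EllipticCurves.Wuthrich2014.ShaBoundProofs
import Literature.NumberTheory.EllipticCurves.Rank1Residual.Typed.X3
import HarnessLib

/-!
# X3 ∧ `r_an = 0` ∧ (semistable twist), `p ≡ 1 (mod 4)`: `ord_p #Ш(E) ≤ ord_p #Ш_an(E)` from the typed `χ`-branch input (cell `b2b-bsdres`, seat additive-p4, line V9)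

HONEST FRAMING (cell `b2b-bsdres`, run/shared/lean/b2b/bsd-rank1-residual/, verbatim in every
file): the goal of the cell is to DELETE the COMBINATION-SHAPED residual classes of the
Birch–Swinnerton-Dyer formula for ALL analytic-rank `≤ 1` elliptic curves over `ℚ` — "full BSD
formula for every rank `≤ 1` curve in class `C`" assembled STRICTLY from published theorems — so
that the rank-`≤ 1` remainder becomes exactly the CONSTRUCTION-SHAPED classes, which are TYPED
(missing-input `Prop`s), NOT attempted. This is not "finishing BSD". The additive sub-cell (seats
additive-p1…p4) is a RESEARCH ROUTE on the construction-shaped classes X3/X4; no claim beyond the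
stated classes; the label of X3 is UNCHANGED by this file (its one non-published input is TYPED).

Theorems only (no definition, no new named fact; every published input is an explicit named-fact
hypothesis, the unpublished joint [B∘C] is the TYPED predicate of `ChiBranchInput.lean`, p203015).
This is the kernel form of the research line V9 of HOME/b2b-bsdres-additive-p4/V9-CHAIN.md (second
reading: HOME/b2b-bsdres-lit/g13/V9-AUDIT.md) at `p ≡ 1 (mod 4)` — the EVEN quadratic branch, the
only one for which the tree has modular-symbol vocabulary (plus symbols):

Setting. `E = W/ℚ` globally minimal, additive at `p` with `E[p]` reducible (class X3,
`Rank1Residual.ClassX3 W p`), of analytic rank `0`, and `ℚ`-isomorphic to the quadratic twist by `p`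
(`= p*` as `p ≡ 1 (mod 4)`) of a globally minimal `V = E♭` which is GOOD ORDINARY (Kodaira `I₀*`,
census cell (G-ord, e = 2)) or MULTIPLICATIVE (`I_n*`, cell (M)) at `p`; `f = f♭` the newform of `V`,
`ϖ · Ω_V = Ω⁺_f`.

* §1 **[D], proved** (`constantCoeff_padicLFunctionBranch_half`): for `V` good ordinary,
  `L_p(f, α, ω^{(p−1)/2}, 0) = α⁻¹ · ∑_{a mod p} (a/p)·[a/p]⁺_f` — from the tree's constant-term
  theorem for the `ω^i`-branches (p202627, Mazur–Tate–Teitelbaum §I.13), the measure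
  `μ(a + pℤ_p) = α⁻¹[a/p]⁺ − α⁻²[0]⁺` ((10.1)), EULER'S CRITERION for the Teichmüller character
  (`teichRep_pow_half_eq_legendreSym`: `ω(a)^{(p−1)/2} = (a/p)` in `ℤ_p`) and `∑_a (a/p) = 0`; hence
  the full-branch input `ChiBranchDivisibilityAt` implies the `T = 0` input `ChiBranchLeadingTermAt`
  pointwise (`constantCoeff_eq_of_iwasawaToPowerSeries_eq_branch`).
* §2 **[E] + [F] + Birch, proved modulo Pal's named fact** (`entireLFunction_one_eq_of_twist`):
  `L(E, 1) = ε · ϖ · (∑_{a mod p} (a/p)[a/p]⁺_f) · Ω_E` with `ε = ±1` — the coefficients of `E` are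
  `(n/p)·aₙ(f)` (`intCast_LFunction_eq_jacobiChar_mul_cuspCoeff`, from the tree's
  `LFunction_quadraticTwist_pStar_apply` and `aₙ(E) = 0` for `p ∣ n` at an additive `p`), Birch's
  formula `(∑ …)·Ω⁺_f = τ(χ_p)·L(E,1)` (tree theorem `ratTwistedSymbolSum_mul_plusPeriod_holds`),
  `τ(χ_p)² = p` (Mathlib `gaussSum_sq`), and Pal 2012 Thm. 3.2 `Ω_V = √p·Ω_E` (p202706).
* §3 bookkeeping: `∏_ℓ c_ℓ = c_p · ∏_{ℓ≠p} c_ℓ`; `1 ≤ c_p ≤ 4` at an additive prime (Kodaira–Néron,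
  tree theorem `index_goodReductionSubgroup_le_four_holds`), so `p ∤ c_p` for `p ≥ 5`; the twist
  relation read backwards; Delbourgo's "(G)-ordinary or (M)" from the twist datum (additive-p2's
  `typeGOrd_of_goodOrd_quadraticTwist`; `ord_p j < 0` for a multiplicative twist).
* §4 **assembly** (`X3RankZeroTwist.missingUpperBoundAt_of_leadingTerm` and its typed-input forms
  `X3RankZeroTwist.missingUpperBoundAt` / `…_of_divisibility`): with [A] Delbourgo 1998 Prop. 4
  (p202678: `p^{ord_p #Ш(p) + ord_p ∏_{ℓ≠p} c_ℓ} ∣ g(0)·#E(ℚ)²` for every `g ∈ char X(E/ℚ_∞)`),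
  [B∘C](0) (typed: some such `g` has `g(0) = u·ϖ·∑(a/p)[a/p]⁺_f`, `u ∈ ℤ_p^×`), §2 and
  Gross–Zagier–Kolyvagin: `ord_p #Ш(E) + ord_p ∏_{ℓ≠p} c_ℓ ≤ ord_p(ϖ·∑…) + 2 ord_p #E(ℚ)
  = ord_p #Ш_an(E) + ord_p ∏_ℓ c_ℓ`, the torsion terms CANCELLING exactly (no image hypothesis),
  whence **`ord_p #Ш(E) ≤ ord_p #Ш_an(E)`** (`Typed.MissingUpperBoundAt W p`), **`BSD(E,p)` on the
  rows with `p ∤ #Ш_an(E)`** (`X3RankZeroTwist.bsdp_of_shaAn_unit`), and the typed X3 input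
  reduced to its LOWER half there (`X3RankZeroTwist.missingPPartAt_iff_lower`).

Why novel (presearch, V9-CHAIN.md): Delbourgo 1998 proves [A] and formulates the main conjecture at
unstable primes; Wuthrich 2014 proves the divisibility for the SEMISTABLE curve `E♭` over
`ℚ(μ_{p^∞})` and draws no consequence for the additive twist; Lei–Pollack et al. arXiv:2412.16629
use `E ↔ E♭` and the same branch for `λ`-invariants, not for `Ш`; Kim–Nakamura 2020 / Kim 2026 need
surjective `ρ̄` (class X4, not X3). No source descends the `χ_p`-branch divisibility of the twist to
`BSD_p` of an additive `I₀*`/`I_n*` Eisenstein curve. Scope: `p ≡ 1 (mod 4)` only (`p = 5` in the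
census range: the (M) and (G-ord, e = 2) X3 pairs at `p = 5`); `p ≡ 3 (mod 4)` (757 of the 818 V9
pairs) needs the MINUS modular symbol / odd branches / `Ω⁻`, definitions the tree does not have.

References: Delbourgo 1998 [Delbourgo1998] Thm. 3, Prop. 4; Wuthrich 2014 [Wuthrich2014] Thm. 16;
Mazur–Tate–Teitelbaum 1986 [MazurTateTeitelbaum1986Invent] §I.10, §I.13–I.14; Pal 2012 [Pal2012]
Thm. 3.2; Greenberg 1999 [GreenbergLNM1716] §5; Miller 2011 [Miller2011LMS] Def. 1.1; Silverman
*ATAEC* IV.9.2 (Kodaira–Néron).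
-/

noncomputable section

open scoped Classical MatrixGroups ModularForm

open CongruenceSubgroup WeierstrassCurve Literature.NumberTheory.EllipticCurves
  Literature.NumberTheory.EllipticCurves.ModularForms
  Literature.NumberTheory.EllipticCurves.Rank1Residual

namespace Summit.BirchSwinnertonDyer.Rank1Residual.Additive

/-! ## §4 The assembly on X3 ∧ `r_an = 0` ∧ (semistable twist), `p ≡ 1 (mod 4)` -/

section Assembly

open IsDedekindDomain NumberField Rat.HeightOneSpectrum
  Literature.NumberTheory.EllipticCurves.Rank1Residual.Typed

variable (W : WeierstrassCurve ℚ) [W.IsElliptic] [W.IsGloballyMinimal] (p : ℕ) [hp : Fact p.Prime]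

omit [W.IsElliptic] [W.IsGloballyMinimal] hp in
/-- A prime `p ≡ 1 (mod 4)` is `≥ 5`. -/
theorem five_le_of_prime_of_mod_four_eq_one (hp4 : p % 4 = 1) (hpP : p.Prime) : 5 ≤ p := by
  by_contra h
  have h1 : p = 1 := by omega
  exact Nat.not_prime_one (h1 ▸ hpP)

/-- Delbourgo's hypothesis "(G)-ordinary or (M)" for the additive curve `E = W` from the twist
datum: a GOOD ORDINARY twist gives (G)-ordinary (additive-p2's
`typeGOrd_of_goodOrd_quadraticTwist`, p199577/PotGoodOrdinary), a MULTIPLICATIVE twist gives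
`ord_p j(E) = ord_p j(E♭) < 0`. -/
theorem typeGOrd_or_padicValRat_j_neg_of_twist (hp4 : p % 4 = 1)
    (V : WeierstrassCurve ℚ) [V.IsElliptic] [V.IsGloballyMinimal]
    (hVW : ∃ C : VariableChange ℚ, C • V.quadraticTwist (p : ℚ) = W) (hV : GoodOrd V p ∨ Mult V p) :
    TypeGOrd W p ∨ padicValRat p W.j < 0 := by
  have hp2 : p ≠ 2 := (by omega)
  have hp0 : (p : ℚ) ≠ 0 := by exact_mod_cast hp.out.ne_zero
  rcases hV with hord | hmult
  · left
    obtain ⟨C₀, hC₀⟩ := exists_variableChange_quadraticTwist_symm W V hp0 hVW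
    have hpstar : ((-1 : ℚ) ^ (p / 2) * p) = (p : ℚ) := by
      have h := neg_one_pow_half_eq_one_of_mod_four_eq_one p hp4
      have h' : ((-1 : ℚ) ^ (p / 2)) = (((-1 : ℤ) ^ (p / 2) : ℤ) : ℚ) := by push_cast; ring
      rw [h', h]
      push_cast
      ring
    refine typeGOrd_of_goodOrd_quadraticTwist W p hp2 V C₀ ?_ hord
    rw [hpstar]
    exact hC₀
  · right
    obtain ⟨C, hC⟩ := hVW
    haveI := V.isElliptic_quadraticTwist (d := (p : ℚ)) hp0
    have hj : W.j = V.j := by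
      subst hC
      rw [variableChange_j, V.j_quadraticTwist hp0]
    rw [hj]
    exact EisensteinPrimes.padicValRat_j_neg_of_mult V p hmult

/-- **Core theorem (line V9, rank 0, `p ≡ 1 (mod 4)`).** Let `E = W` be a globally minimal elliptic
curve over `ℚ` of analytic rank `0` in class X3 at `p ≡ 1 (mod 4)` (`E[p]` reducible, `E` additive
at `p`), `ℚ`-isomorphic to the quadratic twist by `p` of a globally minimal `V = E♭` which is good
ordinary or multiplicative at `p` (Kodaira `I₀*` / `I_n*`), `f` the newform of `V`, `ϖ · Ω_V = Ω⁺_f`.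
ASSUME, at the pair, the typed input [B∘C] at `T = 0` (`hLT`: for the cyclotomic `ℤ_p`-extension and
every Selmer-dual datum `D` of `E` over `ℚ_∞`, some `g ∈ char X(E/ℚ_∞)` has
`g(0) = u · ϖ · ∑ (a/p)[a/p]⁺_f`, `u ∈ ℤ_p^×`). THEN, from PUBLISHED theorems — Delbourgo 1998 Prop. 4
(`hDel`, p202678: `p^{ord #Ш(p) + ord ∏_{ℓ≠p} c_ℓ} ∣ g(0)·#E(ℚ)²`), Pal 2012 Thm. 3.2 (`hPal`,
p202706), Birch's formula and the twist `L`-identity (tree theorems: `L(E,1) = ±ϖ·(∑ …)·Ω_E`),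
Kodaira–Néron (`c_p ≤ 4 < p`), Gross–Zagier–Kolyvagin (`hGZK`) and modularity (`hmod`) — the typed
UPPER half of the `p`-part of BSD holds: `ord_p #Ш(E) ≤ ord_p #Ш_an(E)` (`MissingUpperBoundAt W p`).
The torsion terms cancel exactly (no image hypothesis is needed); `c_p(E)` is a `p`-adic unit. -/
theorem X3RankZeroTwist.missingUpperBoundAt_of_leadingTerm
    (hDel : Delbourgo1998.prop4_rankZero_pow_dvd_constantCoeff)
    (hPal : Pal2012.thm32_sqrt_mul_realPeriodRat_twist_eq_of_prime_one_mod_four)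
    (hGZK : rank_eq_analyticRank_of_analyticRank_le_one) (hmod : hasEntireLFunction_rat)
    (hp4 : p % 4 = 1) (hr : W.analyticRank = 0) (hX : ClassX3 W p)
    (V : WeierstrassCurve ℚ) [V.IsElliptic] [V.IsGloballyMinimal]
    (hVW : ∃ C : VariableChange ℚ, C • V.quadraticTwist (p : ℚ) = W) (hV : GoodOrd V p ∨ Mult V p)
    {N : ℕ} [NeZero N] {f : CuspForm (Gamma0 N) 2} (hf : IsNewformOf V f)
    (ϖ : ℚ) (hϖ : (ϖ : ℝ) * V.realPeriodRat = plusPeriod f)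
    (hLT : ∀ (κ : ZpExtension ℚ p) (γ : Field.absoluteGaloisGroup ℚ),
      κ.IsCyclotomic → κ.IsTopGenerator γ → IsCyclotomicVariable p γ →
      ∀ D : W.SelmerDualData κ γ, ∃ g ∈ D.charIdeal, ∃ u : ℤ_[p]ˣ,
        ((PowerSeries.constantCoeff g : ℤ_[p]) : ℚ_[p]) =
          ((u : ℤ_[p]) : ℚ_[p]) * (ϖ : ℚ_[p]) * (legendrePlusSymbolSum f p : ℚ_[p])) :
    MissingUpperBoundAt W p := by
  classical
  have hpP : p.Prime := hp.out
  have hp2 : p ≠ 2 := (by omega)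
  have hp5 : 5 ≤ p := five_le_of_prime_of_mod_four_eq_one p hp4 hpP
  set v₀ : HeightOneSpectrum (𝓞 ℚ) := (primesEquiv (R := 𝓞 ℚ)).symm ⟨p, hp.out⟩ with hv₀
  -- rank 0: `L(E,1) ≠ 0`, `E(ℚ)` and `Ш` finite
  have hL : W.entireLFunction 1 ≠ 0 := (W.analyticRank_eq_zero_iff_holds (hmod W)).mp hr
  obtain ⟨hmw, hfin⟩ := hGZK W (by rw [hr]; exact zero_le_one)
  have hmw0 : W.mordellWeilRank = 0 := by rw [hmw, hr]
  haveI : Finite W.sha := hfin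
  haveI hE : Finite W.toAffine.Point := W.finite_point_of_rank_zero hmw0
  -- the cyclotomic setting and `X(E/ℚ_∞)`
  obtain ⟨κ, hκ, γ, hγ, hγ'⟩ := exists_isCyclotomic_isTopGenerator_isCyclotomicVariable_holds p
  obtain ⟨D⟩ := W.nonempty_selmerDualData_holds κ γ hγ
  -- [B∘C](0): an element of the characteristic ideal with the analytic constant term
  obtain ⟨g, hgmem, u, hg0⟩ := hLT κ γ hκ hγ hγ' D
  -- [A]: Delbourgo 1998 Prop. 4
  have hGM := typeGOrd_or_padicValRat_j_neg_of_twist W p hp4 V hVW hV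
  obtain ⟨-, hdiv⟩ := hDel W p hp2 hX.2 hGM hr hfin hE κ γ hκ hγ D
  have hdvd := hdiv g hgmem
  -- [E] + [F] + Birch: `L(E,1) = ε ϖ S Ω_E`
  have hV' : Good V p ∨ Mult V p := hV.elim (fun h ↦ Or.inl h.1) Or.inr
  obtain ⟨ε, hε, hLq⟩ := entireLFunction_one_eq_of_twist p hPal hmod hp4 V W hVW hV' hX.2 hf ϖ hϖ
  set S : ℚ := legendrePlusSymbolSum f p with hS
  set q : ℚ := ε * (ϖ * S) with hq
  have hΩ : (W.realPeriodRat : ℂ) ≠ 0 := by exact_mod_cast W.realPeriodRat_pos_holds.ne'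
  have hq' : W.entireLFunction 1 / (W.realPeriodRat : ℂ) = (q : ℂ) := by
    rw [hLq, mul_div_cancel_right₀ _ hΩ]
  obtain ⟨-, -, -, hshaAn⟩ := Wuthrich2014.shaAn_eq_of_L_one_div_eq hGZK W hL hq'
  -- non-vanishing
  have hϖS : ϖ * S ≠ 0 := by
    intro h0
    apply hL
    rw [hLq, hq, h0, mul_zero, Rat.cast_zero, zero_mul]
  have hq0 : q ≠ 0 := by
    rcases hε with h | h <;> simp [hq, h, hϖS]
  have hvq : padicValRat p q = padicValRat p (ϖ * S) := by
    rcases hε with h | h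
    · rw [hq, h, one_mul]
    · rw [hq, h, neg_one_mul, padicValRat.neg]
  -- names for the arithmetic quantities
  set T : ℕ := Nat.card W.toAffine.Point with hT
  set c : ℕ := W.tamagawaNumberAt v₀ with hc
  set P' : ℕ := ∏ᶠ v : HeightOneSpectrum (𝓞 ℚ),
    (if (p : 𝓞 ℚ) ∈ v.asIdeal then 1 else W.tamagawaNumberAt v) with hP'
  have hT0 : T ≠ 0 := by rw [hT]; exact Nat.card_pos.ne'
  have hPsplit : W.tamagawaProduct = c * P' := tamagawaProduct_eq_tamagawaNumberAt_mul_finprod W p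
  have hPpos : 0 < W.tamagawaProduct := W.tamagawaProduct_pos_holds
  have hc0 : c ≠ 0 := fun h ↦ by rw [hPsplit, h, zero_mul] at hPpos; exact lt_irrefl 0 hPpos
  have hP'0 : P' ≠ 0 := fun h ↦ by rw [hPsplit, h, mul_zero] at hPpos; exact lt_irrefl 0 hPpos
  have hvc : padicValNat p c = 0 := padicValNat_tamagawaNumberAt_eq_zero_of_addv W p hX.2 hp5
  have hvP : padicValNat p W.tamagawaProduct = padicValNat p P' := by
    rw [hPsplit, padicValNat.mul hc0 hP'0, hvc, zero_add]
  have hsha : padicValNat p (Nat.card (AddCommGroup.primaryComponent W.sha p)) =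
      padicValNat p W.shaOrder := by
    unfold WeierstrassCurve.shaOrder
    exact padicValNat_card_addPrimaryComponent p
  -- the divisibility in `ℤ_p`, read as an inequality of valuations in `ℚ_p`
  set g0 : ℚ_[p] := ((PowerSeries.constantCoeff g : ℤ_[p]) : ℚ_[p]) with hg0def
  have hg0S : g0 = ((u : ℤ_[p]) : ℚ_[p]) * ((ϖ * S : ℚ) : ℚ_[p]) := by
    rw [hg0]
    push_cast
    ring
  have hϖSQ : ((ϖ * S : ℚ) : ℚ_[p]) ≠ 0 := by exact_mod_cast hϖS
  have hg0ne : g0 ≠ 0 := by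
    rw [hg0S]
    exact mul_ne_zero (coe_units_ne_zero p u) hϖSQ
  have hvg0 : g0.valuation = padicValRat p (ϖ * S) := by
    rw [hg0S, Padic.valuation_mul (coe_units_ne_zero p u) hϖSQ, valuation_coe_units_eq_zero,
      zero_add, Padic.valuation_ratCast]
  have hTQ : ((T : ℕ) : ℚ_[p]) ≠ 0 := by exact_mod_cast hT0
  obtain ⟨c', hc'⟩ := hdvd
  have hkey : g0 * ((T : ℕ) : ℚ_[p]) ^ 2 =
      (p : ℚ_[p]) ^ (padicValNat p (Nat.card (AddCommGroup.primaryComponent W.sha p)) +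
        padicValNat p P') * ((c' : ℤ_[p]) : ℚ_[p]) := by
    have h := congrArg ((↑) : ℤ_[p] → ℚ_[p]) hc'
    push_cast at h
    rw [hg0def]
    exact h
  have hlhs0 : g0 * ((T : ℕ) : ℚ_[p]) ^ 2 ≠ 0 := mul_ne_zero hg0ne (pow_ne_zero 2 hTQ)
  have hc'0 : ((c' : ℤ_[p]) : ℚ_[p]) ≠ 0 := by
    intro h0
    rw [h0, mul_zero] at hkey
    exact hlhs0 hkey
  have hpQ : (p : ℚ_[p]) ≠ 0 := by exact_mod_cast hpP.ne_zero
  have hval := congrArg Padic.valuation hkey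
  rw [Padic.valuation_mul hg0ne (pow_ne_zero 2 hTQ), Padic.valuation_pow, Padic.valuation_natCast,
    hvg0, Padic.valuation_mul (pow_ne_zero _ hpQ) hc'0, Padic.valuation_pow, Padic.valuation_p,
    mul_one, hsha] at hval
  have hc'val : 0 ≤ (((c' : ℤ_[p]) : ℚ_[p])).valuation := PadicInt.valuation_coe_nonneg
  -- (**) `ord_p #Ш + ord_p P' ≤ ord_p(ϖ S) + 2 ord_p T`
  have hineq : (padicValNat p W.shaOrder : ℤ) + padicValNat p P' ≤
      padicValRat p (ϖ * S) + 2 * (padicValNat p T : ℤ) := by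
    simp only [Nat.cast_add, Nat.cast_ofNat] at hval
    linarith
  -- conclusion: `ord_p #Ш ≤ ord_p(q T²/∏ c_ℓ) = ord_p(ϖ S) + 2 ord_p T − ord_p P'`
  refine ⟨q * (T : ℚ) ^ 2 / (W.tamagawaProduct : ℚ), ?_, ?_⟩
  · rw [hshaAn]
  · have hTq : (T : ℚ) ≠ 0 := by exact_mod_cast hT0
    have hPq : (W.tamagawaProduct : ℚ) ≠ 0 := by exact_mod_cast hPpos.ne'
    rw [padicValRat.div (mul_ne_zero hq0 (pow_ne_zero 2 hTq)) hPq,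
      padicValRat.mul hq0 (pow_ne_zero 2 hTq), padicValRat.pow, padicValRat.of_nat,
      padicValRat.of_nat, hvq, hvP]
    simp only [Nat.cast_ofNat]
    linarith

/-- **X3 ∧ `r_an = 0` ∧ (semistable twist) at `p ≡ 1 (mod 4)`: the typed input
`ChiBranchLeadingTermAt W p` ([B∘C] at `T = 0`) delivers the UPPER half of the `p`-part of BSD,
`ord_p #Ш(E) ≤ ord_p #Ш_an(E)`** — every other input being a published theorem (Delbourgo 1998
Prop. 4 `hDel`, Pal 2012 Thm. 3.2 `hPal`, Gross–Zagier–Kolyvagin `hGZK`, modularity `hmod`) or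
proved in the tree (Birch's formula, the twist `L`-identity, Kodaira–Néron). Census domain (ENGINE T,
SHARPENED v3.5 §3): the X3 pairs whose twist by `p*` is good ordinary (`I₀*`, cell (G-ord, e = 2)) or
multiplicative (`I_n*`, cell (M)); at `p ≡ 1 (mod 4)` in the range `N < 2·10⁴` these are the
`p = 5` pairs. Research route; X3 stays construction-shaped (the input is typed, not proved). -/
theorem X3RankZeroTwist.missingUpperBoundAt
    (hDel : Delbourgo1998.prop4_rankZero_pow_dvd_constantCoeff)
    (hPal : Pal2012.thm32_sqrt_mul_realPeriodRat_twist_eq_of_prime_one_mod_four)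
    (hGZK : rank_eq_analyticRank_of_analyticRank_le_one) (hmod : hasEntireLFunction_rat)
    (hBC : ChiBranchLeadingTermAt W p)
    (hp4 : p % 4 = 1) (hr : W.analyticRank = 0) (hX : ClassX3 W p)
    (V : WeierstrassCurve ℚ) [V.IsElliptic] [V.IsGloballyMinimal]
    (hVW : ∃ C : VariableChange ℚ, C • V.quadraticTwist (p : ℚ) = W) (hV : GoodOrd V p ∨ Mult V p)
    {N : ℕ} [NeZero N] {f : CuspForm (Gamma0 N) 2} (hf : IsNewformOf V f)
    (ϖ : ℚ) (hϖ : (ϖ : ℝ) * V.realPeriodRat = plusPeriod f) :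
    MissingUpperBoundAt W p :=
  X3RankZeroTwist.missingUpperBoundAt_of_leadingTerm W p hDel hPal hGZK hmod hp4 hr hX V hVW hV hf ϖ
    hϖ fun _ _ hκ hγ hγ' D ↦ (hBC V hp4 hVW hV hX.1 hκ hγ hγ' hf D ϖ hϖ).2

/-- **The same from the full even-branch input `ChiBranchDivisibilityAt W p`** (Wuthrich-shaped:
`ι g = ϖ · L_p(f♭, α, ω^{(p−1)/2}, T)`), for a GOOD ORDINARY twist (`I₀*`): the value at `T = 0` is
computed in §1 from the tree's branch constant-term theorem (Mazur–Tate–Teitelbaum §I.14 + Euler's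
criterion), so the UPPER half `ord_p #Ш(E) ≤ ord_p #Ш_an(E)` follows as above. -/
theorem X3RankZeroTwist.missingUpperBoundAt_of_divisibility
    (hDel : Delbourgo1998.prop4_rankZero_pow_dvd_constantCoeff)
    (hPal : Pal2012.thm32_sqrt_mul_realPeriodRat_twist_eq_of_prime_one_mod_four)
    (hGZK : rank_eq_analyticRank_of_analyticRank_le_one) (hmod : hasEntireLFunction_rat)
    (hBC : ChiBranchDivisibilityAt W p)
    (hp4 : p % 4 = 1) (hr : W.analyticRank = 0) (hX : ClassX3 W p)
    (V : WeierstrassCurve ℚ) [V.IsElliptic] [V.IsGloballyMinimal]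
    (hVW : ∃ C : VariableChange ℚ, C • V.quadraticTwist (p : ℚ) = W) (hV : GoodOrd V p)
    {N : ℕ} [NeZero N] {f : CuspForm (Gamma0 N) 2} (hf : IsNewformOf V f)
    (ϖ : ℚ) (hϖ : (ϖ : ℝ) * V.realPeriodRat = plusPeriod f) :
    MissingUpperBoundAt W p := by
  have hp2 : p ≠ 2 := (by omega)
  refine X3RankZeroTwist.missingUpperBoundAt_of_leadingTerm W p hDel hPal hGZK hmod hp4 hr hX V hVW
    (Or.inl hV) hf ϖ hϖ fun _ _ hκ hγ hγ' D ↦ ?_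
  obtain ⟨-, g, hgmem, hg⟩ := hBC V hp4 hVW hV hX.1 hκ hγ hγ' hf D ϖ hϖ
  exact ⟨g, hgmem, constantCoeff_eq_of_iwasawaToPowerSeries_eq_branch p hp2 V hV hf hg⟩

omit [W.IsElliptic] [W.IsGloballyMinimal] hp in
/-- Bookkeeping: the UPPER half plus a `p`-unit analytic `Ш` give the whole typed output
`MissingPPartAt W p` (`0 ≤ ord_p #Ш ≤ ord_p #Ш_an = 0`). -/
theorem missingPPartAt_of_upper_of_shaAn_unit (hu : MissingUpperBoundAt W p)
    {q : ℚ} (hq : shaAn W = (q : ℂ)) (hv : padicValRat p q = 0) : MissingPPartAt W p := by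
  obtain ⟨q', hq', hle⟩ := hu
  have hqq : q' = q := by exact_mod_cast hq'.symm.trans hq
  subst hqq
  refine ⟨q', hq', ?_⟩
  rw [hv] at hle ⊢
  have h0 : padicValNat p W.shaOrder = 0 := by exact_mod_cast le_antisymm hle (by positivity)
  rw [h0, Nat.cast_zero]

/-- **`BSD(E,p)` on the `p`-unit rows of X3 ∧ `r_an = 0` ∧ (semistable twist), `p ≡ 1 (mod 4)`,
granted the typed input [B∘C](0)**: if moreover `#Ш_an(E)` is a `p`-adic unit (the lane's exact
value; census: 1271 ‖ 694 of the 1275 ‖ 695 rank-`0` X3 rows have `p ∤ #Ш_an`), then the one-sided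
bound pinches `ord_p #Ш(E) = 0 = ord_p #Ш_an(E)`, i.e. Miller's `BSD(E,p)`
(`Typed.bsdp_of_missingPPartAt`). No Kurihara number, no main conjecture; the published inputs are
named facts, [B∘C] is TYPED. -/
theorem X3RankZeroTwist.bsdp_of_shaAn_unit
    (hDel : Delbourgo1998.prop4_rankZero_pow_dvd_constantCoeff)
    (hPal : Pal2012.thm32_sqrt_mul_realPeriodRat_twist_eq_of_prime_one_mod_four)
    (hGZK : rank_eq_analyticRank_of_analyticRank_le_one) (hmod : hasEntireLFunction_rat)
    (hBC : ChiBranchLeadingTermAt W p)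
    (hp4 : p % 4 = 1) (hr : W.analyticRank = 0) (hX : ClassX3 W p)
    (V : WeierstrassCurve ℚ) [V.IsElliptic] [V.IsGloballyMinimal]
    (hVW : ∃ C : VariableChange ℚ, C • V.quadraticTwist (p : ℚ) = W) (hV : GoodOrd V p ∨ Mult V p)
    {N : ℕ} [NeZero N] {f : CuspForm (Gamma0 N) 2} (hf : IsNewformOf V f)
    (ϖ : ℚ) (hϖ : (ϖ : ℝ) * V.realPeriodRat = plusPeriod f)
    {q : ℚ} (hq : shaAn W = (q : ℂ)) (hv : padicValRat p q = 0) : BSDp W p :=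
  bsdp_of_missingPPartAt W p hGZK (by rw [hr]; exact zero_le_one)
    (missingPPartAt_of_upper_of_shaAn_unit W p
      (X3RankZeroTwist.missingUpperBoundAt W p hDel hPal hGZK hmod hBC hp4 hr hX V hVW hV hf ϖ hϖ)
      hq hv)

/-- **What remains of X3♯ on these pairs is the LOWER half**: granted [B∘C](0), on X3 ∧
`r_an = 0` ∧ (semistable twist) at `p ≡ 1 (mod 4)` the typed missing input of class X3
(`Typed.X3.MissingInputAt = MissingPPartAt`) is EQUIVALENT to `MissingLowerBoundAt W p`
(`ord_p #Ш_an ≤ ord_p #Ш` — the converse / "main-conjecture" direction, Delbourgo's Main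
Conjecture p. 151 in the `χ`-branch). -/
theorem X3RankZeroTwist.missingPPartAt_iff_lower
    (hDel : Delbourgo1998.prop4_rankZero_pow_dvd_constantCoeff)
    (hPal : Pal2012.thm32_sqrt_mul_realPeriodRat_twist_eq_of_prime_one_mod_four)
    (hGZK : rank_eq_analyticRank_of_analyticRank_le_one) (hmod : hasEntireLFunction_rat)
    (hBC : ChiBranchLeadingTermAt W p)
    (hp4 : p % 4 = 1) (hr : W.analyticRank = 0) (hX : ClassX3 W p)
    (V : WeierstrassCurve ℚ) [V.IsElliptic] [V.IsGloballyMinimal]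
    (hVW : ∃ C : VariableChange ℚ, C • V.quadraticTwist (p : ℚ) = W) (hV : GoodOrd V p ∨ Mult V p)
    {N : ℕ} [NeZero N] {f : CuspForm (Gamma0 N) 2} (hf : IsNewformOf V f)
    (ϖ : ℚ) (hϖ : (ϖ : ℝ) * V.realPeriodRat = plusPeriod f) :
    X3.MissingInputAt W p ↔ MissingLowerBoundAt W p :=
  ⟨fun h ↦ (lower_and_upper_of_missingPPartAt W p h).1, fun h ↦
    missingPPartAt_of_lower_of_upper W p h
      (X3RankZeroTwist.missingUpperBoundAt W p hDel hPal hGZK hmod hBC hp4 hr hX V hVW hV hf ϖ hϖ)⟩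

end Assembly

end Summit.BirchSwinnertonDyer.Rank1Residual.Additive

end
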